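import Summits.BirchSwinnertonDyer.Rank1Residual.GaloisImage.InflationRestrictionFiniteQuotient
import Literature.NumberTheory.EllipticCurves.GeomPointsGaloisModule
import HarnessLib

/-!
# Hypothesis (H.3) of Sakamoto 2024 for `T = E[p^{k+1}]`, `T̄ = E[p]` from `−1` in the image:
# the N11 discharge of the binder `hH3`
# (cell `b2b-bsdres`, team n1011, seat p04 gen 3, OWNERS row T-B2 = skel/T-a3-F1-N11.md §3 (B2); file 2/2)

HONEST FRAMING (cell `b2b-bsdres`, run/shared/lean/b2b/bsd-rank1-residual/, verbatim in every
file): the goal of the cell is to DELETE the COMBINATION-SHAPED residual classes of the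
Birch–Swinnerton-Dyer formula for ALL analytic-rank `≤ 1` elliptic curves over `ℚ` — "full BSD
formula for every rank `≤ 1` curve in class `C`" assembled STRICTLY from published theorems — so
that the rank-`≤ 1` remainder becomes exactly the CONSTRUCTION-SHAPED classes, which are TYPED
(missing-input `Prop`s), NOT attempted. This is not "finishing BSD". Team n1011 (N10 / N11, the
additive block X4 ∧ `p = 3`): research route on the CONSTRUCTION-SHAPED class X4; no claim beyond the
stated classes; nothing is booked. Theorems only (no definition, no named fact, no `sorry`).

## Contents (sequel of `GaloisImage/InflationRestrictionFiniteQuotient`: Sah's lemma modulo a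
vanishing subgroup for continuous crossed homomorphisms, `InflRes.h3_of_commute`)

* `InflRes.h3_of_isZero_H1_quotient` — quotient form of the bridge in the fact's (H.3) shape: for
  `N ⊴ Γ_K` inside `{u | ρ u = 1} ∩ Gal(K̄/K(μ_n))` acting trivially on `T̄`, Mathlib's
  `IsZero (groupCohomology.H1 (Rep.of (ρbar….ofQuotient N)))` ⟹ (H.3) (generic, no curve input).
* `exists_smul_eq_neg_of_hasSurjectiveModNGaloisRep`: `ρ̄_{E,n}` surjective ⟹ some `z ∈ Γ_ℚ` acts
  as `−1` on `E[n]`; `smul_eq_neg_torsion_of_smul_eq_neg`: then also on `E[p] ⊆ E[p^k · p]`.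
* `hH3_of_hasSurjectiveModNGaloisRep` — for `E/ℚ`, an odd prime `p` and `ρ̄_{E,p^{k+1}}` surjective,
  hypothesis (H.3) of the tree's fact `Sakamoto2024.kolyvaginSystems_freeRankOne_zmod_three_pow`
  holds for `T = E[p^{k+1}]`, `T̄ = E[p]` at level `p^{k+1}`: every continuous crossed homomorphism
  `Γ_ℚ → E[p]` vanishing on `ker ρ̄_{E,p^{k+1}} ∩ Gal(ℚ̄/ℚ(μ_{p^{k+1}}))` is principal (`−1` is
  central modulo that subgroup and `−1 − 1 = −2` is invertible on `E[p]`).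
* `hH3_self_of_hasSurjectiveModNGaloisRep` — the level-one shape (`T = T̄ = E[p]`, vanishing on
  `ker ρ̄_{E,p} ∩ Gal(ℚ̄/ℚ(μ_p))`) from `ρ̄_{E,p}` surjective ALONE (`p` odd).
* (appendix, generic) `InflRes.isOpen_ker_of_finite`, `InflRes.normal_ker`,
  `InflRes.normal_rootsOfUnityFixer`, `InflRes.normal_ker_inf_rootsOfUnityFixer`,
  `InflRes.isOpen_ker_inf_rootsOfUnityFixer`, `InflRes.mem_ker_inf_rootsOfUnityFixer_iff` and the
  two-way dictionary **`InflRes.h3_iff_isZero_H1_quotient`**: for an open `N = Γ_{K(μ_n,T)}` acting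
  trivially on `T̄`, (H.3) ⟺ `IsZero (groupCohomology.H1 (Rep.of (ρbar….ofQuotient N)))`.
* `hH3_three_of_towerSurj` — at `p = 3` under the `3`-adic tower: VERBATIM the binder `hH3` of
  `GaloisImage.kolyvaginSystems_freeRankOne_propagatedSelmerStructure` (n1011-p13, p255331; same
  spelling of the level `((3 : ℕ) : ℤ) ^ k * ((3 : ℕ) : ℤ)` and of `rootsOfUnityFixer ℚ (3 ^ (k + 1))`;
  checked by partial application `… W hS24 k htower τ hτμ hτq (hH3_three_of_towerSurj W k htower)`).

References: R. Sakamoto, *The theory of Kolyvagin systems for p = 3*, JTNB 36 (2024) §2 (H.3);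
B. Mazur–K. Rubin, *Kolyvagin systems*, Mem. AMS 799 (2004), Lemma 3.5.2; C.-H. Sah, J. Algebra 10
(1968); J.-P. Serre, *Galois Cohomology* (1997), I.§2.6(b).
-/

noncomputable section

open CategoryTheory.Limits Field
open Literature.NumberTheory.GaloisRepresentations

namespace Summit.BirchSwinnertonDyer.Rank1Residual.GaloisImage

/-! ### (H.3) from the group cohomology of a finite quotient (quotient form of the bridge) -/

namespace InflRes

-- Mathlib's `groupCohomology` wants the coefficient ring (`ℤ`) and the group in ONE universe, so the
-- quotient form is stated for fields `K : Type` (as is the fact itself: `M, Mbar : Type`, `K = ℚ`).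
variable {K : Type} [Field K]
variable {M : Type} [AddCommGroup M] [TopologicalSpace M] [DiscreteTopology M]
variable {Mbar : Type} [AddCommGroup Mbar] [TopologicalSpace Mbar] [DiscreteTopology Mbar]

/-- **(H.3) of Sakamoto 2024 from `H¹` of a finite quotient, as GROUP cohomology.** Let `ρ` on `M`
("`T`") and `ρbar` on `Mbar` ("`T̄`") be discrete Galois modules over `K`, and `N ⊴ Γ_K` a normal
subgroup contained in `{u | ρ u = 1} ∩ Gal(K̄/K(μ_n))` (typically equal to it: `Γ_{K(μ_n, T)}`) and
acting trivially on `Mbar`. If Mathlib's group cohomology `H¹(Γ_K ⧸ N, T̄)` vanishes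
(`IsZero (groupCohomology.H1 (Rep.of (ρbar.toRepresentation.ofQuotient N)))` — e.g. by Sah's lemma
for the finite group `Γ_K ⧸ N = Gal(K(μ_n, T)/K)`, x11b3's `X11b.Three.Sah.isZero_H1_of_eq_neg_one`),
then (H.3) holds in the fact's inflation–restriction form: every continuous crossed homomorphism
`Γ_K → T̄` vanishing on `{u | ρ u = 1} ∩ Gal(K̄/K(μ_n))` is principal
(`InflRes.oneCocycleClass_eq_zero_of_vanishing_of_isZero_H1`).
Sakamoto, JTNB 36 (2024) §2 (H.3); Serre, *Galois Cohomology*, I.§2.6(b). [folklore] -/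
theorem h3_of_isZero_H1_quotient (ρ : DiscreteGaloisModule K M) (ρbar : DiscreteGaloisModule K Mbar)
    (n : ℕ) (N : Subgroup (absoluteGaloisGroup K)) [N.Normal]
    (hN : ∀ u ∈ N, ρ u = 1 ∧ u ∈ rootsOfUnityFixer K n)
    [Representation.IsTrivial (ρbar.toTopRep.ρ.toRepresentation.comp N.subtype)]
    (hH : IsZero (groupCohomology.H1 (Rep.of (ρbar.toTopRep.ρ.toRepresentation.ofQuotient N))))
    (f : contOneCocycles ρbar.toTopRep)
    (hf : ∀ u : absoluteGaloisGroup K, ρ u = 1 → u ∈ rootsOfUnityFixer K n → f.1 u = 0) :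
    oneCocycleClass ρbar.toTopRep f = 0 :=
  oneCocycleClass_eq_zero_of_vanishing_of_isZero_H1 ρbar.toTopRep N hH f
    fun u hu => hf u (hN u hu).1 (hN u hu).2

end InflRes

/-! ### The N11 discharge: `hH3` from surjectivity of `ρ̄_{E,p^{k+1}}`, `p` odd -/

section EllipticCurve

open WeierstrassCurve Literature.NumberTheory.EllipticCurves

variable (W : WeierstrassCurve ℚ)

/-- If `ρ̄_{E,n}` is surjective then some `z ∈ Γ_ℚ` acts as `−1` on `E[n]`. [folklore] -/
theorem exists_smul_eq_neg_of_hasSurjectiveModNGaloisRep (n : ℤ)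
    (hsurj : W.HasSurjectiveModNGaloisRep n) :
    ∃ z : absoluteGaloisGroup ℚ, ∀ P : geomTorsion W n, z • P = -P := by
  obtain ⟨z, hz⟩ := hsurj (Multiplicative.ofAdd (AddEquiv.neg (geomTorsion W n)))
  refine ⟨z, fun P => ?_⟩
  rw [← W.galoisRepTorsion_apply n z P, hz]
  rfl

/-- An element acting as `−1` on `E[p^k · p]` acts as `−1` on `E[p] ⊆ E[p^k · p]`. [folklore] -/
theorem smul_eq_neg_torsion_of_smul_eq_neg (p k : ℕ) (z : absoluteGaloisGroup ℚ)
    (hz : ∀ P : geomTorsion W (((p : ℕ) : ℤ) ^ k * ((p : ℕ) : ℤ)), z • P = -P)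
    (x : geomTorsion W ((p : ℕ) : ℤ)) : z • x = -x := by
  have hx' : ((p : ℕ) : ℤ) • (x : geomPoints W) = 0 := (Submodule.mem_torsionBy_iff _ _).mp x.2
  have hx : (x : geomPoints W) ∈ geomTorsion W (((p : ℕ) : ℤ) ^ k * ((p : ℕ) : ℤ)) :=
    (Submodule.mem_torsionBy_iff _ _).mpr (by rw [mul_smul, hx', smul_zero])
  have h := congrArg Subtype.val (hz ⟨x, hx⟩)
  rw [AddSubgroup.torsionBy.coe_smul, NegMemClass.coe_neg] at h
  apply Subtype.ext
  rw [AddSubgroup.torsionBy.coe_smul, NegMemClass.coe_neg]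
  exact h

/-- **The binder `hH3` of the N11 instance, discharged from surjectivity mod `p^{k+1}` (`p` odd).**
For an elliptic curve `E/ℚ`, an odd prime `p` and `k ≥ 0` with `ρ̄_{E,p^{k+1}} : Γ_ℚ → Aut(E[p^{k+1}])`
surjective, hypothesis (H.3) of Sakamoto 2024 holds for `T = E[p^{k+1}]`, `T̄ = E[p]` at level
`p^{k+1}`: every continuous crossed homomorphism `f : Γ_ℚ → E[p]` vanishing on
`ker ρ̄_{E,p^{k+1}} ∩ Gal(ℚ̄/ℚ(μ_{p^{k+1}}))` is principal. (`−1 = ρ̄_{E,p^{k+1}}(z)` is central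
modulo that subgroup and `ρ̄_{E,p}(z) − 1 = −2` is invertible on `E[p]`, `p` odd: Sah's lemma,
`InflRes.h3_of_commute`.) At `p = 3` under the `3`-adic tower (`∀ n, ρ̄_{E,3ⁿ}` onto) this is
VERBATIM the binder `hH3` of
`GaloisImage.kolyvaginSystems_freeRankOne_propagatedSelmerStructure` (n1011-p13, p255331).
Sakamoto, JTNB 36 (2024) §2 (H.3); Mazur–Rubin 2004, Lemma 3.5.2; Sah 1968. [folklore] -/
theorem hH3_of_hasSurjectiveModNGaloisRep (p k : ℕ) [Fact p.Prime] (hp : p ≠ 2)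
    (hsurj : W.HasSurjectiveModNGaloisRep (((p : ℕ) : ℤ) ^ k * ((p : ℕ) : ℤ)))
    (f : contOneCocycles (W.torsionGaloisModule ((p : ℕ) : ℤ)).toTopRep)
    (hf : ∀ u : absoluteGaloisGroup ℚ,
      (W.torsionGaloisModule (((p : ℕ) : ℤ) ^ k * ((p : ℕ) : ℤ))) u = 1 →
        u ∈ rootsOfUnityFixer ℚ (p ^ (k + 1)) → f.1 u = 0) :
    oneCocycleClass (W.torsionGaloisModule ((p : ℕ) : ℤ)).toTopRep f = 0 := by
  have hp0 : p ≠ 0 := (Fact.out : p.Prime).ne_zero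
  haveI : NeZero (p ^ (k + 1)) := ⟨pow_ne_zero _ hp0⟩
  haveI : NeZero ((p ^ (k + 1) : ℕ) : ℚ) := ⟨Nat.cast_ne_zero.mpr (pow_ne_zero _ hp0)⟩
  obtain ⟨z, hz⟩ := exists_smul_eq_neg_of_hasSurjectiveModNGaloisRep W _ hsurj
  have hzp : ∀ x : geomTorsion W ((p : ℕ) : ℤ), z • x = -x :=
    smul_eq_neg_torsion_of_smul_eq_neg W p k z hz
  have hρz : (W.torsionGaloisModule (((p : ℕ) : ℤ) ^ k * ((p : ℕ) : ℤ))) z = -1 :=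
    LinearMap.ext fun x => by rw [torsionGaloisModule_apply_apply, hz]; rfl
  have hρbarz : (W.torsionGaloisModule ((p : ℕ) : ℤ)) z = -1 :=
    LinearMap.ext fun x => by rw [torsionGaloisModule_apply_apply, hzp]; rfl
  have htors : ∀ x : geomTorsion W ((p : ℕ) : ℤ), p • x = 0 := fun x => by
    have hx : ((p : ℕ) : ℤ) • (x : geomPoints W) = 0 := (Submodule.mem_torsionBy_iff _ _).mp x.2
    apply Subtype.ext
    rw [AddSubmonoidClass.coe_nsmul, ZeroMemClass.coe_zero, ← natCast_zsmul]
    exact hx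
  refine InflRes.h3_of_commute (W.torsionGaloisModule (((p : ℕ) : ℤ) ^ k * ((p : ℕ) : ℤ)))
    (W.torsionGaloisModule ((p : ℕ) : ℤ)) (p ^ (k + 1)) z ?_ ?_ ?_ f hf
  · intro g
    rw [hρz]
    exact Commute.neg_one_right _
  · intro g
    rw [hρbarz]
    exact Commute.neg_one_right _
  · exact InflRes.bijective_rho_sub_self_of_eq_neg (W.torsionGaloisModule ((p : ℕ) : ℤ)).toTopRep z
      (fun x => by change z • x = -x; exact hzp x) p ((Fact.out : p.Prime).odd_of_ne_two hp) htors

/-- **Level one (`m = 1`, `T = T̄ = E[p]`) from surjectivity mod `p` ALONE, `p` odd.** Every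
continuous crossed homomorphism `f : Γ_ℚ → E[p]` vanishing on `ker ρ̄_{E,p} ∩ Gal(ℚ̄/ℚ(μ_p))` is
principal, i.e. `H¹(ℚ(E[p], μ_p)/ℚ, E[p]) = 0` in the inflation–restriction form of hypothesis
(H.3) of Sakamoto 2024 at `m = 1` (the shape available on rows where only `ρ̄_{E,3}` onto is known,
not the tower). Sakamoto, JTNB 36 (2024) §2 (H.3); Sah 1968. [folklore] -/
theorem hH3_self_of_hasSurjectiveModNGaloisRep (p : ℕ) [Fact p.Prime] (hp : p ≠ 2)
    (hsurj : W.HasSurjectiveModNGaloisRep ((p : ℕ) : ℤ))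
    (f : contOneCocycles (W.torsionGaloisModule ((p : ℕ) : ℤ)).toTopRep)
    (hf : ∀ u : absoluteGaloisGroup ℚ, (W.torsionGaloisModule ((p : ℕ) : ℤ)) u = 1 →
        u ∈ rootsOfUnityFixer ℚ p → f.1 u = 0) :
    oneCocycleClass (W.torsionGaloisModule ((p : ℕ) : ℤ)).toTopRep f = 0 := by
  have hp0 : p ≠ 0 := (Fact.out : p.Prime).ne_zero
  haveI : NeZero p := ⟨hp0⟩
  haveI : NeZero ((p : ℕ) : ℚ) := ⟨Nat.cast_ne_zero.mpr hp0⟩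
  obtain ⟨z, hz⟩ := exists_smul_eq_neg_of_hasSurjectiveModNGaloisRep W _ hsurj
  have hρz : (W.torsionGaloisModule ((p : ℕ) : ℤ)) z = -1 :=
    LinearMap.ext fun x => by rw [torsionGaloisModule_apply_apply, hz]; rfl
  have htors : ∀ x : geomTorsion W ((p : ℕ) : ℤ), p • x = 0 := fun x => by
    have hx : ((p : ℕ) : ℤ) • (x : geomPoints W) = 0 := (Submodule.mem_torsionBy_iff _ _).mp x.2
    apply Subtype.ext
    rw [AddSubmonoidClass.coe_nsmul, ZeroMemClass.coe_zero, ← natCast_zsmul]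
    exact hx
  refine InflRes.h3_of_commute (W.torsionGaloisModule ((p : ℕ) : ℤ))
    (W.torsionGaloisModule ((p : ℕ) : ℤ)) p z ?_ ?_ ?_ f hf
  · intro g
    rw [hρz]
    exact Commute.neg_one_right _
  · intro g
    rw [hρz]
    exact Commute.neg_one_right _
  · exact InflRes.bijective_rho_sub_self_of_eq_neg (W.torsionGaloisModule ((p : ℕ) : ℤ)).toTopRep z
      (fun x => by change z • x = -x; exact hz x) p ((Fact.out : p.Prime).odd_of_ne_two hp) htors

/-- **`p = 3`, under the `3`-adic tower: the binder `hH3` of the N11 instance VERBATIM.** For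
`E/ℚ` with `ρ̄_{E,3ⁿ}` surjective for every `n` and any `k ≥ 0`, every continuous crossed
homomorphism `f : Γ_ℚ → E[3]` vanishing on `ker ρ̄_{E,3^{k+1}} ∩ Gal(ℚ̄/ℚ(μ_{3^{k+1}}))` is
principal — hypothesis `hH3` of
`GaloisImage.kolyvaginSystems_freeRankOne_propagatedSelmerStructure` (same spelling of the level
`((3 : ℕ) : ℤ) ^ k * ((3 : ℕ) : ℤ)` and of `rootsOfUnityFixer ℚ (3 ^ (k + 1))`), discharged by
`hH3_of_hasSurjectiveModNGaloisRep` at `p = 3` from `htower (k + 1)`.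
Sakamoto, JTNB 36 (2024) §2 (H.3). [folklore] -/
theorem hH3_three_of_towerSurj (k : ℕ) (htower : ∀ n : ℕ, W.HasSurjectiveModNGaloisRep (3 ^ n : ℕ))
    (f : contOneCocycles (W.torsionGaloisModule ((3 : ℕ) : ℤ)).toTopRep)
    (hf : ∀ u : absoluteGaloisGroup ℚ,
      (W.torsionGaloisModule (((3 : ℕ) : ℤ) ^ k * ((3 : ℕ) : ℤ))) u = 1 →
        u ∈ rootsOfUnityFixer ℚ (3 ^ (k + 1)) → f.1 u = 0) :
    oneCocycleClass (W.torsionGaloisModule ((3 : ℕ) : ℤ)).toTopRep f = 0 :=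
  haveI : Fact (Nat.Prime 3) := ⟨Nat.prime_three⟩
  hH3_of_hasSurjectiveModNGaloisRep W 3 k (by decide)
    (by simpa only [Nat.cast_pow, Nat.cast_mul, pow_succ] using htower (k + 1)) f hf

end EllipticCurve

/-! ### The two-way dictionary for FINITE modules: (H.3) ⟺ `H¹(Gal(K(μ_n, T)/K), T̄) = 0` -/

namespace InflRes

section OpenKernel

universe u

variable {K : Type u} [Field K]
variable {M : Type u} [AddCommGroup M] [TopologicalSpace M] [DiscreteTopology M]

/-- The kernel of a discrete Galois module on a FINITE module is open (a finite intersection of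
open stabilisers). Serre, *Galois Cohomology*, I.§2.1. [folklore] -/
theorem isOpen_ker_of_finite [Finite M] (ρ : DiscreteGaloisModule K M) :
    IsOpen (ρ.ker : Set (absoluteGaloisGroup K)) := by
  have h : (ρ.ker : Set (absoluteGaloisGroup K)) = ⋂ m : M, {σ | ρ σ m = m} := by
    ext σ
    simp [LinearMap.ext_iff, Set.mem_iInter]
  rw [h]
  exact isOpen_iInter_of_finite fun m => ρ.isOpen_setOf_apply_eq m

/-- The kernel of a discrete Galois module is a normal subgroup. [folklore] -/
theorem normal_ker (ρ : DiscreteGaloisModule K M) : ρ.ker.Normal :=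
  MonoidHom.normal_ker ρ.toRepresentation

/-- `Gal(K̄/K(μ_n))` is a normal subgroup of `Γ_K` (`n` invertible in `K`). [folklore] -/
theorem normal_rootsOfUnityFixer (n : ℕ) [NeZero n] [NeZero (n : K)] :
    (rootsOfUnityFixer K n).Normal := by
  rw [rootsOfUnityFixer_eq_ker]
  exact MonoidHom.normal_ker _

/-- `Γ_{K(μ_n, T)} = ker ρ ∩ Gal(K̄/K(μ_n))` is a normal subgroup of `Γ_K`. [folklore] -/
theorem normal_ker_inf_rootsOfUnityFixer (ρ : DiscreteGaloisModule K M) (n : ℕ) [NeZero n]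
    [NeZero (n : K)] : (ρ.ker ⊓ rootsOfUnityFixer K n).Normal := by
  haveI := normal_ker ρ
  haveI := normal_rootsOfUnityFixer (K := K) n
  infer_instance

/-- `Γ_{K(μ_n, T)}` is open for `T` finite (`K(μ_n, T)/K` is a finite extension). [folklore] -/
theorem isOpen_ker_inf_rootsOfUnityFixer [Finite M] (ρ : DiscreteGaloisModule K M) (n : ℕ)
    [NeZero n] [NeZero (n : K)] :
    IsOpen ((ρ.ker ⊓ rootsOfUnityFixer K n : Subgroup (absoluteGaloisGroup K)) :
      Set (absoluteGaloisGroup K)) :=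
  (isOpen_ker_of_finite ρ).inter (isOpen_rootsOfUnityFixer K n)

/-- Membership in `Γ_{K(μ_n, T)} = ker ρ ∩ Gal(K̄/K(μ_n))`, in the spelling of the fact's (H.3)
(`ρ u = 1`). [folklore] -/
theorem mem_ker_inf_rootsOfUnityFixer_iff (ρ : DiscreteGaloisModule K M) (n : ℕ)
    (u : absoluteGaloisGroup K) :
    u ∈ ρ.ker ⊓ rootsOfUnityFixer K n ↔ ρ u = 1 ∧ u ∈ rootsOfUnityFixer K n := by
  rw [Subgroup.mem_inf, ContinuousRep.mem_ker]
  exact Iff.rfl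

end OpenKernel

-- `K : Type` again (Mathlib's `groupCohomology`: one universe for `ℤ` and `Γ_K`).
variable {K : Type} [Field K]
variable {M : Type} [AddCommGroup M] [TopologicalSpace M] [DiscreteTopology M]
variable {Mbar : Type} [AddCommGroup Mbar] [TopologicalSpace Mbar] [DiscreteTopology Mbar]

/-- **(H.3) ⟺ vanishing of the finite quotient's group `H¹` ("`H¹` of the finite quotient = kernel of
restriction on continuous cocycles").** Let `ρ` on `M` ("`T`"), `ρbar` on `Mbar` ("`T̄`") be discrete
Galois modules over `K`, and `N ⊴ Γ_K` an OPEN normal subgroup with `N = {u | ρ u = 1} ∩ Gal(K̄/K(μ_n))`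
(i.e. `N = Γ_{K(μ_n, T)}`; open e.g. for `T` finite and `n` invertible in `K`:
`isOpen_ker_inf_rootsOfUnityFixer`, `normal_ker_inf_rootsOfUnityFixer`, `mem_ker_inf_rootsOfUnityFixer_iff`)
acting trivially on `T̄`. Then hypothesis (H.3) of the tree's fact
`Sakamoto2024.kolyvaginSystems_freeRankOne_zmod_three_pow` (every continuous crossed homomorphism
`Γ_K → T̄` vanishing on `N` is principal) holds IF AND ONLY IF Mathlib's group cohomology
`H¹(Γ_K ⧸ N, T̄) = H¹(Gal(K(μ_n, T)/K), T̄)` vanishes (`InflRes.isZero_H1_ofQuotient_iff`).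
Serre, *Galois Cohomology*, I.§2.6(b); Sakamoto, JTNB 36 (2024) §2 (H.3). [folklore] -/
theorem h3_iff_isZero_H1_quotient (ρ : DiscreteGaloisModule K M) (ρbar : DiscreteGaloisModule K Mbar)
    (n : ℕ) (N : Subgroup (absoluteGaloisGroup K)) [N.Normal]
    (hN : ∀ u, u ∈ N ↔ ρ u = 1 ∧ u ∈ rootsOfUnityFixer K n)
    (hNo : IsOpen (N : Set (absoluteGaloisGroup K)))
    [Representation.IsTrivial (ρbar.toTopRep.ρ.toRepresentation.comp N.subtype)] :
    (∀ f : contOneCocycles ρbar.toTopRep,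
        (∀ u : absoluteGaloisGroup K, ρ u = 1 → u ∈ rootsOfUnityFixer K n → f.1 u = 0) →
          oneCocycleClass ρbar.toTopRep f = 0) ↔
      IsZero (groupCohomology.H1 (Rep.of (ρbar.toTopRep.ρ.toRepresentation.ofQuotient N))) := by
  rw [isZero_H1_ofQuotient_iff ρbar.toTopRep N hNo]
  constructor
  · intro h φ hφN
    exact h φ fun u hu hμ => hφN u ((hN u).mpr ⟨hu, hμ⟩)
  · intro h f hf
    exact h f fun u hu => hf u ((hN u).mp hu).1 ((hN u).mp hu).2

end InflRes

end Summit.BirchSwinnertonDyer.Rank1Residual.GaloisImage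

end
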